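import Mathlib

/-!
# Valuative independence of exponent vectors ("exact-order lemma")

A tool for the local (formal Laurent / Hahn series) analysis of the cruxes `PeelingLemma`,
`BinomialCandidate`, `BinomialMapsElusive` of route `BinomialElusive` (structure note
`Cruxes/BinomialMapsElusive/STRUCTURE-p1.md`, fact (F2)).

Let `L_j` (`j ∈ σ`) be Hahn series with coefficients in a torsion-free abelian group `V` and let
`n_i ∈ ℤ^σ` (`i ∈ ι`) be integer vectors.  If the combinations `S_i := Σ_j n_i(j) • L_j` are nonzero
with PAIRWISE DISTINCT orders, then the `n_i` are `ℤ`-linearly independent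
(`linearIndependent_of_orderTop_injective`); in particular there are at most `|σ|` of them
(`card_le_of_orderTop_injective`).  Proof: in a dependency `Σ g_i n_i = 0` look at the index `i₀`
with `g_{i₀} ≠ 0` of least order; `g_{i₀} S_{i₀} = -Σ_{i ≠ i₀} g_i S_i` has order `ord S_{i₀}` on the
left and strictly larger order on the right.

Typical use (with `L_j = log` of the principal-unit part of a Laurent solution `p_j`): the set of
exact orders `{ord Σ_j n(j) L_j : n ∈ ℤ^σ} \ {∞}` has at most `|σ|` elements; e.g. `m` monomial
coordinates `p^{A_i} = t^{a_i}(1 + t^{g_i})` with pairwise distinct gaps `g_i` force `m ≤ |σ|`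
(the local form of `ToricBinomialElusive`), and for binomial maps the depths / gaps of the
coordinates must COINCIDE in all but `≤ |σ|` values.

The second section redoes the argument MULTIPLICATIVELY for principal units `w_j` (`ord(w_j - 1) > 0`)
of a Hahn-series field of characteristic `0` — no formal logarithm needed
(`linearIndependent_of_orderTop_monomial_injective`, `card_le_of_orderTop_monomial_injective`) — and
records the application `card_le_of_monomial_add_eq_one_add_single`: monomials with
`w^{A_i} + r_i = 1 + t^{g_i}`, `ord r_i > g_i`, `g` injective, number at most `|σ|` (local toric
theorem for `r = 0`; "some coordinate of a binomial swallower is shallow, tied or cancelling" for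
`r_i = β̃_i t^{d_i} w^{B_i}`).  Mathlib only.
-/

-- layout Summits/ValiantsHypothesis/ValiantsHypothesis forces the duplicated namespace component
set_option linter.dupNamespace false

namespace Summit.ValiantsHypothesis.ValiantsHypothesis.Theorems.BinomialMapsElusiveExactOrders

open scoped BigOperators
open Finset

variable {Γ : Type*} [LinearOrder Γ] {V : Type*} [AddCommGroup V] [NoZeroSMulDivisors ℤ V]

/-- Scaling by a nonzero integer does not change the order of a Hahn series with torsion-free
coefficients. -/
theorem orderTop_zsmul {z : ℤ} (hz : z ≠ 0) (x : HahnSeries Γ V) :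
    (z • x).orderTop = x.orderTop := by
  by_cases hx : x = 0
  · simp [hx]
  have hzx : z • x ≠ 0 := by
    intro h
    apply hx
    ext a
    have := congr_arg (fun y : HahnSeries Γ V => y.coeff a) h
    simp only [HahnSeries.coeff_smul, HahnSeries.coeff_zero, smul_eq_zero] at this
    exact this.resolve_left hz
  refine le_antisymm ?_ (HahnSeries.orderTop_le_orderTop_smul z x)
  rw [HahnSeries.orderTop_of_ne_zero hx, HahnSeries.orderTop_of_ne_zero hzx, WithTop.coe_le_coe]
  refine Set.IsWF.min_le_min_of_subset fun a ha => ?_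
  rw [HahnSeries.mem_support] at ha ⊢
  simpa [HahnSeries.coeff_smul, smul_eq_zero, hz] using ha

omit [NoZeroSMulDivisors ℤ V] in
/-- A strict lower bound on the orders of the summands is a strict lower bound on the order of a
finite sum (the empty sum has order `⊤`). -/
theorem lt_orderTop_sum {ι : Type*} (s : Finset ι) (f : ι → HahnSeries Γ V) {c : WithTop Γ}
    (hc : c ≠ ⊤) (h : ∀ i ∈ s, c < (f i).orderTop) : c < (∑ i ∈ s, f i).orderTop := by
  classical
  induction s using Finset.induction_on with
  | empty => simpa using lt_top_iff_ne_top.mpr hc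
  | insert a s ha ih =>
    rw [Finset.sum_insert ha]
    have h1 : c < (f a).orderTop := h a (Finset.mem_insert_self a s)
    have h2 : c < (∑ i ∈ s, f i).orderTop := ih fun i hi => h i (Finset.mem_insert_of_mem hi)
    exact lt_of_lt_of_le (lt_min h1 h2) HahnSeries.min_orderTop_le_orderTop_add

/-- **Exact-order lemma.**  Integer vectors `n_i` whose combinations `Σ_j n_i(j) • L_j` of the
Hahn series `L_j` are nonzero with pairwise distinct orders are `ℤ`-linearly independent. -/
theorem linearIndependent_of_orderTop_injective {σ ι : Type*} [Fintype σ]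
    (L : σ → HahnSeries Γ V) (n : ι → σ → ℤ)
    (hne : ∀ i, ∑ j, n i j • L j ≠ 0)
    (hinj : Function.Injective fun i => (∑ j, n i j • L j).orderTop) :
    LinearIndependent ℤ n := by
  classical
  set S : ι → HahnSeries Γ V := fun i => ∑ j, n i j • L j with hS
  rw [linearIndependent_iff']
  intro t g hsum
  by_contra hcon
  push Not at hcon
  obtain ⟨i₁, hi₁t, hgi₁⟩ := hcon
  -- the indices with nonzero coefficient, and the one of least order among them
  set t' : Finset ι := t.filter fun i => g i ≠ 0 with ht'
  have ht'ne : t'.Nonempty := ⟨i₁, Finset.mem_filter.mpr ⟨hi₁t, hgi₁⟩⟩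
  obtain ⟨i₀, hi₀, hmin⟩ := Finset.exists_min_image t' (fun i => (S i).orderTop) ht'ne
  have hgi₀ : g i₀ ≠ 0 := (Finset.mem_filter.mp hi₀).2
  -- the dependency transported to the series: `Σ_{i ∈ t'} g_i • S_i = 0`
  have hdep : ∑ i ∈ t', g i • S i = 0 := by
    have h1 : ∑ i ∈ t', g i • S i = ∑ i ∈ t, g i • S i := by
      refine Finset.sum_subset (Finset.filter_subset _ _) fun i hit hit' => ?_
      have : g i = 0 := by simpa [ht', hit] using hit'
      simp [this]
    have h2 : ∑ i ∈ t, g i • S i = ∑ j, (∑ i ∈ t, g i * n i j) • L j := by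
      simp only [hS, Finset.smul_sum, smul_smul]
      rw [Finset.sum_comm]
      refine Finset.sum_congr rfl fun j _ => ?_
      rw [Finset.sum_smul]
    have h3 : ∀ j, ∑ i ∈ t, g i * n i j = 0 := fun j => by
      have := congr_fun hsum j
      simpa [Finset.sum_apply, Pi.smul_apply, smul_eq_mul] using this
    rw [h1, h2]
    simp [h3]
  -- isolate the term of least order
  have hiso : g i₀ • S i₀ = -∑ i ∈ t'.erase i₀, g i • S i := by
    rw [eq_neg_iff_add_eq_zero, add_comm, Finset.sum_erase_add _ _ hi₀]
    exact hdep
  have hlt : (S i₀).orderTop < (∑ i ∈ t'.erase i₀, g i • S i).orderTop := by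
    refine lt_orderTop_sum _ _ (HahnSeries.orderTop_ne_top.mpr (hne i₀)) fun i hi => ?_
    obtain ⟨hii₀, hit'⟩ := Finset.mem_erase.mp hi
    have hgi : g i ≠ 0 := (Finset.mem_filter.mp hit').2
    rw [orderTop_zsmul hgi]
    exact lt_of_le_of_ne (hmin i hit') fun h => hii₀ (hinj h.symm)
  have : (S i₀).orderTop < (S i₀).orderTop := by
    calc (S i₀).orderTop < (∑ i ∈ t'.erase i₀, g i • S i).orderTop := hlt
      _ = (g i₀ • S i₀).orderTop := by rw [hiso, HahnSeries.orderTop_neg]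
      _ = (S i₀).orderTop := orderTop_zsmul hgi₀ _
  exact lt_irrefl _ this

/-- **Exact-order lemma, counting form.**  At most `|σ|` integer combinations of `|σ|` Hahn series
can be nonzero with pairwise distinct orders. -/
theorem card_le_of_orderTop_injective {σ ι : Type*} [Fintype σ] [Fintype ι]
    (L : σ → HahnSeries Γ V) (n : ι → σ → ℤ)
    (hne : ∀ i, ∑ j, n i j • L j ≠ 0)
    (hinj : Function.Injective fun i => (∑ j, n i j • L j).orderTop) :
    Fintype.card ι ≤ Fintype.card σ := by
  have h := (linearIndependent_of_orderTop_injective L n hne hinj).fintype_card_le_finrank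
  rwa [Module.finrank_fintype_fun_eq_card] at h


/-! ## Multiplicative form: principal units of a Hahn-series field

For the applications the series are the principal-unit parts `w_j = p_j / (π_j t^{ν_j})` of a Laurent
solution `p`, and the combinations are the monomials `w^{n} = Π_j w_j^{n_j}`; the role of the order of
`Σ n_j L_j` is played by the order of `w^n - 1`.  We redo the argument multiplicatively (no formal
logarithm needed): a *principal unit* is an `x` with `0 < (x - 1).orderTop`. -/

section Multiplicative

variable {Δ : Type*} [AddCommGroup Δ] [LinearOrder Δ] [IsOrderedAddMonoid Δ]
  {R : Type*} [Field R]

/-- A principal unit has order `0`; in particular it is nonzero. -/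
theorem orderTop_eq_zero_of_principal {x : HahnSeries Δ R} (hx : 0 < (x - 1).orderTop) :
    x.orderTop = 0 := by
  have h1 : (1 : HahnSeries Δ R).orderTop = 0 := by
    rw [← HahnSeries.single_zero_one, HahnSeries.orderTop_single one_ne_zero]; rfl
  have : x = 1 + (x - 1) := by ring
  rw [this, HahnSeries.orderTop_add_eq_left (h1.symm ▸ hx), h1]

/-- A principal unit is nonzero. -/
theorem ne_zero_of_principal {x : HahnSeries Δ R} (hx : 0 < (x - 1).orderTop) : x ≠ 0 := by
  intro h
  have := orderTop_eq_zero_of_principal hx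
  rw [h, HahnSeries.orderTop_zero] at this
  exact WithTop.top_ne_zero this

/-- Products with a principal unit `y`: `ord(xy - 1) ≥ min(ord(x - 1), ord(y - 1))`. -/
theorem min_le_orderTop_mul_sub_one (x : HahnSeries Δ R) {y : HahnSeries Δ R}
    (hy : 0 < (y - 1).orderTop) :
    min (x - 1).orderTop (y - 1).orderTop ≤ (x * y - 1).orderTop := by
  have hxy : x * y - 1 = (x - 1) * (y - 1) + ((x - 1) + (y - 1)) := by ring
  have hprod : min (x - 1).orderTop (y - 1).orderTop ≤ ((x - 1) * (y - 1)).orderTop := by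
    rw [HahnSeries.orderTop_mul]
    exact le_trans (min_le_left _ _) (le_add_of_nonneg_right hy.le)
  have hsum : min (x - 1).orderTop (y - 1).orderTop ≤ ((x - 1) + (y - 1)).orderTop :=
    HahnSeries.min_orderTop_le_orderTop_add
  rw [hxy]
  exact le_trans (le_min hprod hsum) HahnSeries.min_orderTop_le_orderTop_add

/-- Products of principal units are principal units. -/
theorem principal_mul {x y : HahnSeries Δ R} (hx : 0 < (x - 1).orderTop)
    (hy : 0 < (y - 1).orderTop) : 0 < (x * y - 1).orderTop :=
  lt_of_lt_of_le (lt_min hx hy) (min_le_orderTop_mul_sub_one x hy)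

/-- Natural powers of principal units are principal units. -/
theorem principal_pow {x : HahnSeries Δ R} (hx : 0 < (x - 1).orderTop) (n : ℕ) :
    0 < (x ^ n - 1).orderTop := by
  induction n with
  | zero => simp
  | succ n ih => rw [pow_succ]; exact principal_mul ih hx

/-- The inverse of a principal unit: `ord(x⁻¹ - 1) = ord(x - 1)`. -/
theorem orderTop_inv_sub_one {x : HahnSeries Δ R} (hx : 0 < (x - 1).orderTop) :
    (x⁻¹ - 1).orderTop = (x - 1).orderTop := by
  have hx0 : x ≠ 0 := ne_zero_of_principal hx
  have hinv : x⁻¹.orderTop = 0 := by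
    have h := HahnSeries.orderTop_mul x x⁻¹
    rw [mul_inv_cancel₀ hx0, orderTop_eq_zero_of_principal hx, zero_add] at h
    rw [← h, ← HahnSeries.single_zero_one, HahnSeries.orderTop_single one_ne_zero]; rfl
  have : x⁻¹ - 1 = x⁻¹ * (-(x - 1)) := by field_simp; ring
  rw [this, HahnSeries.orderTop_mul, hinv, zero_add, HahnSeries.orderTop_neg]

/-- A strict lower bound on `ord(x_j - 1)` for principal units `x_j` is a strict lower bound on
`ord(Π_j x_j - 1)`. -/
theorem lt_orderTop_prod_sub_one {ι : Type*} (s : Finset ι) (x : ι → HahnSeries Δ R)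
    (hx : ∀ i ∈ s, 0 < (x i - 1).orderTop) {c : WithTop Δ} (hc : c ≠ ⊤)
    (h : ∀ i ∈ s, c < (x i - 1).orderTop) :
    0 < (∏ i ∈ s, x i - 1).orderTop ∧ c < (∏ i ∈ s, x i - 1).orderTop := by
  classical
  induction s using Finset.induction_on with
  | empty => simp [lt_top_iff_ne_top.mpr hc]
  | insert a s ha ih =>
    have hxa := hx a (Finset.mem_insert_self a s)
    obtain ⟨ih1, ih2⟩ := ih (fun i hi => hx i (Finset.mem_insert_of_mem hi))
      (fun i hi => h i (Finset.mem_insert_of_mem hi))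
    rw [Finset.prod_insert ha]
    refine ⟨principal_mul hxa ih1, ?_⟩
    exact lt_of_lt_of_le (lt_min (h a (Finset.mem_insert_self a s)) ih2)
      (min_le_orderTop_mul_sub_one (x a) ih1)

variable [CharZero R]

/-- Powers of principal units in characteristic zero: `ord(xⁿ - 1) = ord(x - 1)` for `n ≥ 1`. -/
theorem orderTop_pow_sub_one {x : HahnSeries Δ R} (hx : 0 < (x - 1).orderTop) {n : ℕ}
    (hn : n ≠ 0) : (x ^ n - 1).orderTop = (x - 1).orderTop := by
  -- `xⁿ - 1 = G · (x - 1)` with `G = Σ_{i<n} xⁱ = n + Σ_{i<n} (xⁱ - 1)` of order `0`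
  have hgeom : (∑ i ∈ Finset.range n, x ^ i) * (x - 1) = x ^ n - 1 := geom_sum_mul x n
  have hC : (HahnSeries.C (n : R) : HahnSeries Δ R).orderTop = 0 := by
    rw [HahnSeries.C_apply, HahnSeries.orderTop_single (Nat.cast_ne_zero.mpr hn)]; rfl
  have hrest : (0 : WithTop Δ) < (∑ i ∈ Finset.range n, (x ^ i - 1)).orderTop := by
    refine lt_orderTop_sum _ _ WithTop.zero_ne_top fun i _ => ?_
    by_cases hi : i = 0
    · simp [hi]
    · exact principal_pow hx i |>.trans_le le_rfl
  have hG : (∑ i ∈ Finset.range n, x ^ i) =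
      HahnSeries.C (n : R) + ∑ i ∈ Finset.range n, (x ^ i - 1) := by
    rw [Finset.sum_sub_distrib, Finset.sum_const, Finset.card_range, nsmul_eq_mul, mul_one]
    simp [map_natCast]
  have hGord : (∑ i ∈ Finset.range n, x ^ i).orderTop = 0 := by
    rw [hG, HahnSeries.orderTop_add_eq_left (hC.symm ▸ hrest), hC]
  rw [← hgeom, HahnSeries.orderTop_mul, hGord, zero_add]

/-- Integer powers of principal units in characteristic zero: `ord(x^q - 1) = ord(x - 1)` for
`q ≠ 0`. -/
theorem orderTop_zpow_sub_one {x : HahnSeries Δ R} (hx : 0 < (x - 1).orderTop) {q : ℤ}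
    (hq : q ≠ 0) : (x ^ q - 1).orderTop = (x - 1).orderTop := by
  obtain ⟨n, rfl | rfl⟩ := Int.eq_nat_or_neg q
  · have hn : n ≠ 0 := by rintro rfl; exact hq (by simp)
    rw [zpow_natCast, orderTop_pow_sub_one hx hn]
  · have hn : n ≠ 0 := by rintro rfl; exact hq (by simp)
    rw [zpow_neg, zpow_natCast, orderTop_inv_sub_one (principal_pow hx n),
      orderTop_pow_sub_one hx hn]

/-- Integer powers of principal units are principal units. -/
theorem principal_zpow {x : HahnSeries Δ R} (hx : 0 < (x - 1).orderTop) (q : ℤ) :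
    0 < (x ^ q - 1).orderTop := by
  by_cases hq : q = 0
  · simp [hq]
  · rw [orderTop_zpow_sub_one hx hq]; exact hx

omit [CharZero R] in
/-- `Π_i a ^ (f i) = a ^ (Σ_i f i)` for integer exponents and `a ≠ 0`. -/
theorem prod_zpow_eq_zpow_sum {ι : Type*} (s : Finset ι) (f : ι → ℤ) {a : HahnSeries Δ R}
    (ha : a ≠ 0) : ∏ i ∈ s, a ^ f i = a ^ ∑ i ∈ s, f i := by
  classical
  induction s using Finset.induction_on with
  | empty => simp
  | insert b s hb ih => rw [Finset.prod_insert hb, Finset.sum_insert hb, zpow_add₀ ha, ih]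

/-- **Exact-order lemma, multiplicative form.**  Let `w_j` be principal units of a Hahn-series
field (characteristic `0`) and `n_i ∈ ℤ^σ` integer vectors such that the monomials
`w^{n_i} = Π_j w_j ^ n_i(j)` are `≠ 1` with pairwise distinct orders of `w^{n_i} - 1`.  Then the `n_i`
are `ℤ`-linearly independent. -/
theorem linearIndependent_of_orderTop_monomial_injective {σ ι : Type*} [Fintype σ]
    (w : σ → HahnSeries Δ R) (hw : ∀ j, 0 < (w j - 1).orderTop) (n : ι → σ → ℤ)
    (hne : ∀ i, ∏ j, w j ^ n i j ≠ 1)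
    (hinj : Function.Injective fun i => (∏ j, w j ^ n i j - 1).orderTop) :
    LinearIndependent ℤ n := by
  classical
  set E : ι → HahnSeries Δ R := fun i => ∏ j, w j ^ n i j with hE
  have hEp : ∀ i, 0 < (E i - 1).orderTop := fun i =>
    (lt_orderTop_prod_sub_one Finset.univ (fun j => w j ^ n i j)
      (fun j _ => principal_zpow (hw j) _) WithTop.zero_ne_top
      (fun j _ => principal_zpow (hw j) _)).1
  rw [linearIndependent_iff']
  intro t g hsum
  by_contra hcon
  push Not at hcon
  obtain ⟨i₁, hi₁t, hgi₁⟩ := hcon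
  set t' : Finset ι := t.filter fun i => g i ≠ 0 with ht'
  have ht'ne : t'.Nonempty := ⟨i₁, Finset.mem_filter.mpr ⟨hi₁t, hgi₁⟩⟩
  obtain ⟨i₀, hi₀, hmin⟩ := Finset.exists_min_image t' (fun i => (E i - 1).orderTop) ht'ne
  have hgi₀ : g i₀ ≠ 0 := (Finset.mem_filter.mp hi₀).2
  -- the dependency transported to the monomials: `Π_{i ∈ t'} (E i)^{g i} = 1`
  have hcoef : ∀ j, ∑ i ∈ t', n i j * g i = 0 := fun j => by
    have h1 : ∑ i ∈ t', n i j * g i = ∑ i ∈ t, g i * n i j := by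
      rw [Finset.sum_filter]
      refine Finset.sum_congr rfl fun i _ => ?_
      by_cases h : g i = 0 <;> simp [h, mul_comm]
    have h2 := congr_fun hsum j
    simp only [Finset.sum_apply, Pi.smul_apply, smul_eq_mul, Pi.zero_apply] at h2
    rw [h1, h2]
  have hdep : ∏ i ∈ t', E i ^ g i = 1 := by
    calc ∏ i ∈ t', E i ^ g i = ∏ i ∈ t', ∏ j, w j ^ (n i j * g i) := by
          refine Finset.prod_congr rfl fun i _ => ?_
          rw [hE, ← Finset.prod_zpow]
          exact Finset.prod_congr rfl fun j _ => (zpow_mul _ _ _).symm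
      _ = ∏ j, ∏ i ∈ t', w j ^ (n i j * g i) := Finset.prod_comm
      _ = ∏ j, w j ^ ∑ i ∈ t', n i j * g i :=
          Finset.prod_congr rfl fun j _ => prod_zpow_eq_zpow_sum _ _ (ne_zero_of_principal (hw j))
      _ = 1 := by simp [hcoef]
  -- isolate the monomial of least order: `(E i₀)^{-g i₀} = Π_{i ≠ i₀} (E i)^{g i}`
  have hE0 : E i₀ ≠ 0 := ne_zero_of_principal (hEp i₀)
  have hiso : E i₀ ^ (-g i₀) = ∏ i ∈ t'.erase i₀, E i ^ g i := by
    have h := Finset.mul_prod_erase t' (fun i => E i ^ g i) hi₀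
    rw [hdep] at h
    rw [zpow_neg, ← mul_right_inj' (zpow_ne_zero (g i₀) hE0), mul_inv_cancel₀ (zpow_ne_zero _ hE0)]
    exact h.symm
  have ho₀ : (E i₀ - 1).orderTop ≠ ⊤ := HahnSeries.orderTop_ne_top.mpr (sub_ne_zero.mpr (hne i₀))
  have hlt : (E i₀ - 1).orderTop < (∏ i ∈ t'.erase i₀, E i ^ g i - 1).orderTop := by
    refine (lt_orderTop_prod_sub_one _ _ (fun i _ => principal_zpow (hEp i) _) ho₀
      fun i hi => ?_).2
    obtain ⟨hii₀, hit'⟩ := Finset.mem_erase.mp hi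
    have hgi : g i ≠ 0 := (Finset.mem_filter.mp hit').2
    rw [orderTop_zpow_sub_one (hEp i) hgi]
    exact lt_of_le_of_ne (hmin i hit') fun h => hii₀ (hinj h.symm)
  have : (E i₀ - 1).orderTop < (E i₀ - 1).orderTop := by
    calc (E i₀ - 1).orderTop < (∏ i ∈ t'.erase i₀, E i ^ g i - 1).orderTop := hlt
      _ = (E i₀ ^ (-g i₀) - 1).orderTop := by rw [hiso]
      _ = (E i₀ - 1).orderTop := orderTop_zpow_sub_one (hEp i₀) (neg_ne_zero.mpr hgi₀)
  exact lt_irrefl _ this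

/-- **Exact-order lemma, multiplicative counting form.**  At most `|σ|` monomials in `|σ|`
principal units can be `≠ 1` with pairwise distinct orders of `w^{n} - 1`. -/
theorem card_le_of_orderTop_monomial_injective {σ ι : Type*} [Fintype σ] [Fintype ι]
    (w : σ → HahnSeries Δ R) (hw : ∀ j, 0 < (w j - 1).orderTop) (n : ι → σ → ℤ)
    (hne : ∀ i, ∏ j, w j ^ n i j ≠ 1)
    (hinj : Function.Injective fun i => (∏ j, w j ^ n i j - 1).orderTop) :
    Fintype.card ι ≤ Fintype.card σ := by
  have h := (linearIndependent_of_orderTop_monomial_injective w hw n hne hinj).fintype_card_le_finrank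
  rwa [Module.finrank_fintype_fun_eq_card] at h

/-- **Application (local toric / deep-coordinate bound).**  If `|ι|` monomials `w^{A_i}` in the
principal units `w_j` (`j ∈ σ`) satisfy `w^{A_i} + r_i = 1 + t^{g_i}` with corrections `r_i` of
order `> g_i` and pairwise distinct gaps `g_i`, then `|ι| ≤ |σ|`.  With `r_i = 0` this is the local
(formal) form of `ToricBinomialElusive`; with `r_i = β̃_i t^{d_i} w^{B_i}`, `d_i > g_i`, it says that a
binomial swallower has at most `|σ|` DEEP honest coordinates — some coordinate must be shallow
(`d_i ≤ g_i`), tied or cancelling. -/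
theorem card_le_of_monomial_add_eq_one_add_single {σ ι : Type*} [Fintype σ] [Fintype ι]
    (w : σ → HahnSeries Δ R) (hw : ∀ j, 0 < (w j - 1).orderTop) (A : ι → σ → ℤ)
    (g : ι → Δ) (hg : Function.Injective g) (r : ι → HahnSeries Δ R)
    (hr : ∀ i, ((g i : Δ) : WithTop Δ) < (r i).orderTop)
    (heq : ∀ i, ∏ j, w j ^ A i j + r i = 1 + HahnSeries.single (g i) 1) :
    Fintype.card ι ≤ Fintype.card σ := by
  have hord : ∀ i, (∏ j, w j ^ A i j - 1).orderTop = g i := fun i => by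
    have h1 : ∏ j, w j ^ A i j - 1 = HahnSeries.single (g i) (1 : R) + (-r i) := by
      rw [← sub_eq_zero]
      have := heq i
      rw [← sub_eq_zero] at this
      rw [← this]
      ring
    have h2 : (HahnSeries.single (g i) (1 : R)).orderTop = g i :=
      HahnSeries.orderTop_single one_ne_zero
    rw [h1, HahnSeries.orderTop_add_eq_left (by rw [h2, HahnSeries.orderTop_neg]; exact hr i), h2]
  refine card_le_of_orderTop_monomial_injective w hw A (fun i h => ?_) (fun i i' h => ?_)
  · have := hord i
    rw [h, sub_self, HahnSeries.orderTop_zero] at this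
    exact WithTop.top_ne_coe this
  · have h' : ((g i : Δ) : WithTop Δ) = g i' := by rw [← hord i, ← hord i']; exact h
    exact hg (WithTop.coe_injective h')

end Multiplicative

end Summit.ValiantsHypothesis.ValiantsHypothesis.Theorems.BinomialMapsElusiveExactOrders
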